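import Mathlib
import Summits.Ventures.PercRepro2.HCov
import Summits.Ventures.PercRepro2.IsolatedMark
import Summits.Ventures.PercRepro2.GcSkelRules
import Summits.Ventures.PercRepro2.GcSkelReduction
import Summits.Ventures.PercRepro2.GcSkelReductionP
import Summits.Ventures.PercRepro2.GcSkelReductionI
import Summits.Ventures.PercRepro2.GcBlockConn
import Summits.Ventures.PercRepro2.GcBlock

/-!
# The residual with no collapsible block (blind cell PercRepro2, typer-1 g54)

`GcBlock.lean` adds one REDUCTION to the weighted calculus: a two-terminal block `W` carrying no
mark (`Block.IsBlock ends W u v`, every edge touching `W` inside `W ∪ {u, v}`) is one edge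
`{u, v}` of weight `P(u ↔ v inside the block)` — exactly, for `Gc` — and the collapse lowers
`nonLoopCard` whenever two non-loop edges touch `W`, or the terminals coincide and one does
(`Block.HasBlock`). This contains the unmarked-leaf and series moves and the pruning of a
mark-free side at a cut vertex, and is new for the mark-free side of a separating PAIR.

**`WReducedT`** := `WReducedI` ∧ no collapsible block; **`HCov_all_iff_HCovWRedT_all`** — one
strong induction on `nonLoopCard` (`HCov_of_wredT_of_base`) carrying every move and class
theorem of the lane, the block collapse first; and the shape it forces:
**`block_isolated_of_wredT`** — on the residual, every vertex of a mark-free two-terminal block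
has non-loop degree `0` (an unmarked vertex has non-loop degree `0` or `≥ 3`, and a block touched
by two non-loop edges collapses): beyond isolated vertices, every separating pair `{u, v}` of the
residual has a mark on each side.
-/

namespace Summit.Ventures.PercRepro2

open CovForm Contract RECM CutVertexM9 SepPair

namespace WRed

/-! ## The residual with no collapsible block -/

section ClassT

variable {V : Type*} {E : Type*} [Fintype E] [DecidableEq E] [DecidableEq V]

/-- **The residual with no collapsible block**: `WReducedI`, and no mark-free two-terminal block
the collapse shrinks. -/
structure WReducedT (ends : E → Sym2 V) (o a₁ a₂ a₃ b : V) : Prop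
    extends WReducedI ends o a₁ a₂ a₃ b where
  /-- no mark-free two-terminal block with two non-loop edges touching it, and none with
  coinciding terminals and a non-loop edge touching it -/
  noBlock : ¬ Block.HasBlock ends o a₁ a₂ a₃ b

end ClassT

section Closure

variable (R : Type*) [Field R] [LinearOrder R] [IsStrictOrderedRing R]

/-- **(HCOV) on the residual with no collapsible block**. -/
def HCovWRedT_all : Prop :=
  ∀ (V E : Type) [Fintype V] [DecidableEq V] [Fintype E] [DecidableEq E]
    (ends : E → Sym2 V) (p : E → R), IsProbVec p →
    ∀ o a₁ a₂ a₃ b : V, a₁ ≠ a₂ → a₁ ≠ a₃ → a₂ ≠ a₃ → o ≠ a₁ → o ≠ a₂ → o ≠ a₃ → o ≠ b →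
      b ≠ a₁ → b ≠ a₂ → b ≠ a₃ → WReducedT ends o a₁ a₂ a₃ b → HCov p ends o a₁ a₂ a₃ b

end Closure

section Main

variable {R : Type*} [Field R] [LinearOrder R] [IsStrictOrderedRing R]

/-- **The reduction to the residual with no collapsible block**, by strong induction on the number
of non-loop edges over all finite edge types: the block collapse (`GcBlock.lean`), the isolated
marks, every move of `GcSkelReductionC.lean`, the pendant-root contraction (p5 g24), and every
class theorem of the lane; else the instance is in `WReducedT`. -/
theorem HCov_of_wredT_of_base (hB : HCovWRedT_all R) (n : ℕ) :
    ∀ (V E : Type) [Fintype V] [DecidableEq V] [Fintype E] [DecidableEq E] (ends : E → Sym2 V),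
      nonLoopCard ends = n → ∀ (p : E → R), IsProbVec p →
      ∀ o a₁ a₂ a₃ b : V, a₁ ≠ a₂ → a₁ ≠ a₃ → a₂ ≠ a₃ → o ≠ a₁ → o ≠ a₂ → o ≠ a₃ → o ≠ b →
        b ≠ a₁ → b ≠ a₂ → b ≠ a₃ → HCov p ends o a₁ a₂ a₃ b := by
  induction n using Nat.strong_induction_on with
  | _ n ih =>
  intro V E _ _ _ _ ends hn p hp o a₁ a₂ a₃ b h12 h13 h23 ho1 ho2 ho3 hob hb1 hb2 hb3
  have ih' : IHBelow R V E n := fun ends' hlt => ih _ hlt V E ends' rfl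
  -- the block collapse: a mark-free two-terminal block is one edge (`GcBlock.lean`)
  by_cases hBlk : Block.HasBlock ends o a₁ a₂ a₃ b
  · exact Block.HCov_of_hasBlock hp (fun ends' hlt p' hp' => ih' ends' (hn ▸ hlt) p' hp' o a₁ a₂ a₃ b
      h12 h13 h23 ho1 ho2 ho3 hob hb1 hb2 hb3) hBlk
  -- an isolated mark among `a₁, a₂, o, b` (p5 g24)
  by_cases hiso : IsolatedMark.IsIsolated ends a₁ ∨ IsolatedMark.IsIsolated ends a₂ ∨
      IsolatedMark.IsIsolated ends o ∨ IsolatedMark.IsIsolated ends b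
  · exact IsolatedMark.HCov_isolated_mark p h12 h13 h23 ho1 ho2 hb1 hb2 hiso
  push Not at hiso
  by_cases hsimp : Simple ends
  swap
  · unfold Simple at hsimp
    push Not at hsimp
    obtain ⟨g₁, g₂, hg12, hnd, hpar⟩ := hsimp
    obtain ⟨u, v, huv⟩ : ∃ u v, ends g₁ = s(u, v) :=
      (Sym2.exists (f := fun t => ends g₁ = t)).1 ⟨ends g₁, rfl⟩
    have hnd2 : ¬ (ends g₂).IsDiag := by rw [← hpar]; exact hnd
    unfold HCov
    rw [Gc_parallel p hg12 hpar.symm u o a₁ a₂ a₃ b]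
    exact ih' _ (hn ▸ nonLoopCard_update_loop_lt ends hnd2 u) _ (isProbVec_parallel hp g₁ g₂)
      o a₁ a₂ a₃ b h12 h13 h23 ho1 ho2 ho3 hob hb1 hb2 hb3
  by_cases hun : ∃ y, Unmarked o a₁ a₂ a₃ b y ∧ (nonLoopDeg ends y = 1 ∨ nonLoopDeg ends y = 2)
  · obtain ⟨y, hy, hd⟩ := hun
    rcases hd with h1 | h2
    · obtain ⟨e, x, he, hxy, hleaf⟩ := leaf_of_nonLoopDeg_one h1
      have hne : ¬ (ends e).IsDiag := by
        rw [he, Sym2.mk_isDiag_iff]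
        exact hxy
      unfold HCov
      rw [Gc_leaf_at p he hxy hy hleaf]
      exact ih' _ (hn ▸ nonLoopCard_update_loop_lt ends hne x) p hp o a₁ a₂ a₃ b h12 h13 h23
        ho1 ho2 ho3 hob hb1 hb2 hb3
    · obtain ⟨e, f, x, w, hef, he, hf, hxy, hyw, hdeg⟩ := series_of_nonLoopDeg_two h2
      unfold HCov
      rw [Gc_series_at p he hf hef hxy hyw hy hdeg]
      exact ih' _ (hn ▸ nonLoopCard_contract_lt ends hxy he) _ (isProbVec_series hp e f)
        o a₁ a₂ a₃ b h12 h13 h23 ho1 ho2 ho3 hob hb1 hb2 hb3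
  by_cases hdo : nonLoopDeg ends o = 1
  · exact HCov_of_o_leaf ih' ends hn p hp o a₁ a₂ a₃ b h12 h13 h23 ho1 ho2 ho3 hob hb1 hb2 hb3
      hdo
  by_cases hdb : nonLoopDeg ends b = 1
  · exact HCov_of_b_leaf ih' ends hn p hp o a₁ a₂ a₃ b h12 h13 h23 ho1 ho2 ho3 hob hb1 hb2 hb3
      hdb
  by_cases h3 : ∃ (e : E) (x : V), ends e = s(x, a₃) ∧ x ≠ a₃ ∧ nonLoopDeg ends a₃ = 1 ∧
      ¬ Unmarked o a₁ a₂ a₃ b x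
  · obtain ⟨e, x, he, hx, hd, hm⟩ := h3
    exact HCov_of_a3_leaf_marked ends p hp o a₁ a₂ a₃ b h13 h23 ho3 hb3 hd ⟨e, x, he, hx, hm⟩
  by_cases h1 : ∃ (e : E) (x : V), ends e = s(x, a₁) ∧ x ≠ a₁ ∧ nonLoopDeg ends a₁ = 1 ∧
      ¬ Unmarked o a₁ a₂ a₃ b x
  · obtain ⟨e, x, he, hx, hd, hm⟩ := h1
    exact HCov_of_a1_leaf_marked ends p hp o a₁ a₂ a₃ b h12 h13 ho1 hb1 hd ⟨e, x, he, hx, hm⟩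
  by_cases h2 : ∃ (e : E) (x : V), ends e = s(x, a₂) ∧ x ≠ a₂ ∧ nonLoopDeg ends a₂ = 1 ∧
      ¬ Unmarked o a₁ a₂ a₃ b x
  · obtain ⟨e, x, he, hx, hd, hm⟩ := h2
    exact HCov_of_a2_leaf_marked ends p hp o a₁ a₂ a₃ b h12 h23 ho2 hb2 hd ⟨e, x, he, hx, hm⟩
  push Not at h1 h2
  -- a pendant `a₁` at an unmarked vertex: contract it (p5 g24)
  by_cases hd1 : nonLoopDeg ends a₁ = 1
  · obtain ⟨ends₁, e, x, h₁e, hx1, hleaf₁, hagree, hagree', he, -⟩ := exists_relocated hd1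
    have hx : Unmarked o a₁ a₂ a₃ b x := h1 e x he hx1 hd1
    have hGc : Gc p ends o a₁ a₂ a₃ b = Gc p ends₁ o a₁ a₂ a₃ b :=
      Gc_eq_of_agree_nonLoop p hagree hagree' o a₁ a₂ a₃ b
    have hcard : nonLoopCard ends₁ ≤ n := hn ▸ nonLoopCard_le_of_agree hagree'
    have hf₁ : ends₁ e = s(a₁, x) := by rw [h₁e, Sym2.eq_swap]
    unfold HCov
    rw [hGc]
    refine LeafRoot.HCov_pendant_root_contract' p hp hf₁ hleaf₁ hx ho1 h12.symm h13.symm hb1 ?_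
    exact ih _ (lt_of_lt_of_le (nonLoopCard_contract_lt ends₁ hx1.symm hf₁) hcard) V E _ rfl p hp
      o a₁ a₂ a₃ b h12 h13 h23 ho1 ho2 ho3 hob hb1 hb2 hb3
  -- a pendant `a₂` at an unmarked vertex: contract it (p5 g24)
  by_cases hd2 : nonLoopDeg ends a₂ = 1
  · obtain ⟨ends₁, e, x, h₁e, hx2, hleaf₁, hagree, hagree', he, -⟩ := exists_relocated hd2
    have hx : Unmarked o a₁ a₂ a₃ b x := h2 e x he hx2 hd2
    have hGc : Gc p ends o a₁ a₂ a₃ b = Gc p ends₁ o a₁ a₂ a₃ b :=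
      Gc_eq_of_agree_nonLoop p hagree hagree' o a₁ a₂ a₃ b
    have hcard : nonLoopCard ends₁ ≤ n := hn ▸ nonLoopCard_le_of_agree hagree'
    have hf₁ : ends₁ e = s(a₂, x) := by rw [h₁e, Sym2.eq_swap]
    unfold HCov
    rw [hGc]
    refine LeafRoot.HCov_pendant_root_contract p hp hf₁ hleaf₁ hx ho2 h12 h23.symm hb2 ?_
    exact ih _ (lt_of_lt_of_le (nonLoopCard_contract_lt ends₁ hx2.symm hf₁) hcard) V E _ rfl p hp
      o a₁ a₂ a₃ b h12 h13 h23 ho1 ho2 ho3 hob hb1 hb2 hb3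
  -- the cut-vertex moves
  by_cases hP : ∃ (side : E → Bool) (L : Set V) (v : V) (Rt : Set V) (g : E),
      CutVertex ends side L v Rt ∧ (∀ m ∈ ({o, a₁, a₂, a₃, b} : Set V), m ∈ Rt ∨ m = v) ∧
      side g = true ∧ ¬ (ends g).IsDiag
  · obtain ⟨side, L, v, Rt, g, h, hM, hg, hgd⟩ := hP
    exact CutPrune.HCov_of_right h p o a₁ a₂ a₃ b hM
      (ih _ (hn ▸ nonLoopCard_prune_lt hg hgd) V _ (CutPrune.rends ends side) rfl _
        (CutPrune.isProbVec_rweights hp) o a₁ a₂ a₃ b h12 h13 h23 ho1 ho2 ho3 hob hb1 hb2 hb3)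
  by_cases hO : ∃ (side : E → Bool) (L : Set V) (v : V) (Rt : Set V) (w : V),
      CutVertex ends side L v Rt ∧ w ∈ L ∧
      (∀ m ∈ ({o, a₁, a₂, a₃, b} : Set V), m = w ∨ m ∈ Rt ∨ m = v) ∧ 1 < leftCard ends side
  · obtain ⟨side, L, v, Rt, w, h, hw, hM, hlt⟩ := hO
    obtain ⟨g₁, hg₁, g₂, hg₂, hne⟩ := Finset.one_lt_card.1 hlt
    rw [Finset.mem_filter] at hg₁ hg₂
    exact CutOneFar.HCov_of_reduced h hw p o a₁ a₂ a₃ b hM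
      (ih _ (hn ▸ nonLoopCard_oneFar_lt v w hne hg₁.2.1 hg₁.2.2 hg₂.2.1 hg₂.2.2) V _
        (CutOneFar.rends ends side v w) rfl _
        (CutOneFar.isProbVec_rweights_leftProb ends side v w hp) o a₁ a₂ a₃ b h12 h13 h23 ho1
        ho2 ho3 hob hb1 hb2 hb3)
  by_cases hT : ∃ (side : E → Bool) (L : Set V) (v : V) (Rt : Set V),
      CutVertex ends side L v Rt ∧ TwoThree L v Rt o a₁ a₂ a₃ b
  · obtain ⟨side, L, v, Rt, h, htt⟩ := hT
    exact CutTwoFar.HCov_cut_twoLeft h hp htt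
  -- the class theorems
  by_cases hR : RootsToMarks ends o a₁ a₂ a₃ b
  · exact HubAll.HCovR_all_holds V E ends p hp o a₁ a₂ a₃ b h12 h13 h23 ho1 ho2 ho3 hob hb1 hb2
      hb3 hR
  by_cases hR3 : A3RECM.A3ToMarks ends o a₁ a₂ a₃ b
  · exact HubAll.HCovR3_all_holds V E ends p hp o a₁ a₂ a₃ b h12 h13 h23 ho1 ho2 ho3 hob hb1 hb2
      hb3 hR3
  by_cases hPk : ∃ P : Finset V, PocketConn.IsPocket ends (↑P : Set V) a₁ a₂ ∧ a₃ ∈ P ∧ a₁ ∉ P ∧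
      a₂ ∉ P ∧ o ∉ P ∧ b ∉ P
  · obtain ⟨P, hPk, h3', h1', h2', ho', hb'⟩ := hPk
    exact PocketConn.HCov_pocket p hp hPk h12 h1' h2' ho' hb' h3'
  by_cases hs2 : b ∈ cluster ends (sepConfig ends {a₁, a₂}) o
  swap
  · unfold HCov
    rw [SepTwoGcZero.Gc_eq_zero_of_sepPair hp ends a₃ b (by simp [ho1, ho2]) hs2]
  by_cases hs3 : a₂ ∉ cluster ends (sepConfig ends {a₁, a₃}) o ∪ {a₁, a₃} ∧
      b ∉ cluster ends (sepConfig ends {a₁, a₃}) o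
  · unfold HCov
    rw [SepThreeGcZero.Gc_eq_zero_of_sepThree hp ends (by simp [ho1, ho3]) hs3.1 hs3.2]
  by_cases hs3' : a₁ ∉ cluster ends (sepConfig ends {a₂, a₃}) o ∪ {a₂, a₃} ∧
      b ∉ cluster ends (sepConfig ends {a₂, a₃}) o
  · unfold HCov
    rw [SepThreeGcZero.Gc_eq_zero_of_sepThree' hp ends (by simp [ho2, ho3]) hs3'.1 hs3'.2]
  by_cases hN : ∃ (q : Fin 5 → V) (blk : E → Fin 5) (Vj : Fin 5 → Set V),
      Cycle.IsNecklace ends q blk Vj ∧ ∃ ko k₁ k₂ k₃ kb : Fin 5, ko ≠ k₁ ∧ ko ≠ k₂ ∧ ko ≠ k₃ ∧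
      ko ≠ kb ∧ k₁ ≠ k₂ ∧ k₁ ≠ k₃ ∧ k₁ ≠ kb ∧ k₂ ≠ k₃ ∧ k₂ ≠ kb ∧ k₃ ≠ kb ∧
      q ko = o ∧ q k₁ = a₁ ∧ q k₂ = a₂ ∧ q k₃ = a₃ ∧ q kb = b
  · obtain ⟨q, blk, Vj, hNk, ko, k₁, k₂, k₃, kb, h01, h02, h03, h04, h12', h13', h14, h23', h24,
      h34, rfl, rfl, rfl, rfl, rfl⟩ := hN
    exact Cycle.HCov_necklace hNk p hp ko k₁ k₂ k₃ kb h01 h02 h03 h04 h12' h13' h14 h23' h24 h34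
  by_cases h5 : BlockSubst.FiveTerminalClass ends o a₁ a₂ a₃ b
  · exact BlockSubst.HCov_of_fiveTerminalClass ends o a₁ a₂ a₃ b h5 p hp
  by_cases h6 : BlockSubst.SixTerminalClass ends o a₁ a₂ a₃ b
  · exact BlockSubst.HCov_of_sixTerminalClass ends o a₁ a₂ a₃ b h6 p hp
  by_cases h7 : Seven.SevenSkelClass ends o a₁ a₂ a₃ b
  · exact Seven.HCov_of_sevenSkelClass ends o a₁ a₂ a₃ b h7 p hp
  by_cases h7' : Seven.SevenSkelClass ends o a₂ a₁ a₃ b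
  · exact Seven.HCov_of_sevenSkelClass' ends o a₁ a₂ a₃ b h7' p hp
  -- the residual with no collapsible block
  push Not at hun h3 hP hO hT hPk hs3 hs3' hN
  exact hB V E ends p hp o a₁ a₂ a₃ b h12 h13 h23 ho1 ho2 ho3 hob hb1 hb2 hb3
    ⟨⟨⟨⟨⟨⟨⟨⟨⟨⟨hsimp, hun, hdo, hdb⟩, h3, h1, h2⟩, hP, hO, hT⟩, hR, hR3, hPk, hs2, hs3, hs3'⟩, hN⟩,
      h5, h6⟩, h7, h7'⟩, hd1, hd2⟩, hiso.1, hiso.2.1, hiso.2.2.1, hiso.2.2.2⟩, hBlk⟩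


/-- **THE WEIGHTED RESIDUAL WITH NO COLLAPSIBLE BLOCK**: (HCOV) for every finite weighted graph
with five distinct marks follows from (HCOV) on `WReducedT`. -/
theorem HCov_all_of_HCovWRedT_all (hB : HCovWRedT_all R) : HCov_all R := by
  intro V E _ _ _ _ ends p hp o a₁ a₂ a₃ b h12 h13 h23 ho1 ho2 ho3 hob hb1 hb2 hb3
  exact HCov_of_wredT_of_base hB _ V E ends rfl p hp o a₁ a₂ a₃ b h12 h13 h23 ho1 ho2 ho3 hob hb1
    hb2 hb3

/-- The residual with no collapsible block is a faithful reduction: `HCov_all ↔ HCovWRedT_all`. -/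
theorem HCov_all_iff_HCovWRedT_all : HCov_all R ↔ HCovWRedT_all R :=
  ⟨fun h V E _ _ _ _ ends p hp o a₁ a₂ a₃ b h12 h13 h23 ho1 ho2 ho3 hob hb1 hb2 hb3 _ =>
    h V E ends p hp o a₁ a₂ a₃ b h12 h13 h23 ho1 ho2 ho3 hob hb1 hb2 hb3,
   HCov_all_of_HCovWRedT_all⟩

/-- The two residuals are equivalent closures: `HCovWRedI_all ↔ HCovWRedT_all`. -/
theorem HCovWRedI_all_iff_HCovWRedT_all : HCovWRedI_all R ↔ HCovWRedT_all R := by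
  rw [← HCov_all_iff_HCovWRedI_all, ← HCov_all_iff_HCovWRedT_all]

end Main

/-! ## The shape: mark-free blocks of the residual are isolated vertices -/

section Shape

variable {V : Type*} {E : Type*} [Fintype E] [DecidableEq E] [DecidableEq V]

omit [DecidableEq E] in
/-- A non-loop edge at a vertex of `W` touches `W`. -/
lemma mem_touches_of_mem_edgesAt {ends : E → Sym2 V} {W : Set V} {y : V} (hy : y ∈ W) {g : E}
    (hg : g ∈ edgesAt ends y) : g ∈ touches ends W := by
  obtain ⟨hyg, -⟩ := mem_edgesAt.1 hg
  obtain ⟨x, hx⟩ := Sym2.mem_iff_exists.mp hyg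
  exact ⟨y, hy, x, hx⟩

/-- **On the residual, a mark-free two-terminal block is touched by at most one non-loop edge**,
and by none when its terminals coincide. -/
theorem block_edges_of_wredT {ends : E → Sym2 V} {o a₁ a₂ a₃ b : V}
    (h : WReducedT ends o a₁ a₂ a₃ b) {W : Set V} {u v : V} (hB : Block.IsBlock ends W u v)
    (hW : ∀ y ∈ W, Unmarked o a₁ a₂ a₃ b y) :
    (∀ e₀ e₁, e₀ ∈ touches ends W → e₁ ∈ touches ends W → ¬ (ends e₀).IsDiag →
      ¬ (ends e₁).IsDiag → e₀ = e₁) ∧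
    (u = v → ∀ e₀ ∈ touches ends W, (ends e₀).IsDiag) := by
  refine ⟨fun e₀ e₁ he₀ he₁ hd₀ hd₁ => ?_, fun huv e₀ he₀ => ?_⟩
  · by_contra hne
    exact h.noBlock ⟨W, u, v, hB, hW, Or.inl ⟨e₀, e₁, hne, he₀, he₁, hd₀, hd₁⟩⟩
  · by_contra hd₀
    exact h.noBlock ⟨W, u, v, hB, hW, Or.inr ⟨huv, e₀, he₀, hd₀⟩⟩

/-- **On the residual, every vertex of a mark-free two-terminal block has non-loop degree `0`**:
an unmarked vertex has non-loop degree `0` or `≥ 3`, and two non-loop edges at a vertex of the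
block would both touch it. -/
theorem block_isolated_of_wredT {ends : E → Sym2 V} {o a₁ a₂ a₃ b : V}
    (h : WReducedT ends o a₁ a₂ a₃ b) {W : Set V} {u v : V} (hB : Block.IsBlock ends W u v)
    (hW : ∀ y ∈ W, Unmarked o a₁ a₂ a₃ b y) {y : V} (hy : y ∈ W) : nonLoopDeg ends y = 0 := by
  by_contra hne
  have hdeg := h.unmarked y (hW y hy)
  have h2 : 1 < nonLoopDeg ends y := by
    rcases Nat.lt_or_ge 1 (nonLoopDeg ends y) with hlt | hle
    · exact hlt
    · rcases Nat.le_one_iff_eq_zero_or_eq_one.1 hle with h0 | h1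
      · exact absurd h0 hne
      · exact absurd h1 hdeg.1
  obtain ⟨g₁, hg₁, g₂, hg₂, hne'⟩ := Finset.one_lt_card.1 h2
  exact hne' ((block_edges_of_wredT h hB hW).1 g₁ g₂ (mem_touches_of_mem_edgesAt hy hg₁)
    (mem_touches_of_mem_edgesAt hy hg₂) (mem_edgesAt.1 hg₁).2 (mem_edgesAt.1 hg₂).2)

end Shape

end WRed

end Summit.Ventures.PercRepro2
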